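import Literature.AlgebraicGeometry.HodgeTheory.FermatHodgeCharacterRigidity
import Literature.AlgebraicGeometry.HodgeTheory.FermatHodgeCharacterExistence
import Mathlib.Data.Nat.Factorization.Basic
import HarnessLib

/-!
# Global Dirichlet characters with prescribed local components (support for Aoki 1983, §§3, 6–9)

Support file V (everything PROVED; no named facts, no definitions) for the structure theorem of
the Hodge characters of the Fermat surface (`AokiShioda1983_thmB2m_standard`). For a level `f`
and local characters `ψ_p` mod `p^{v_p(f)}` (one for each prime `p ∣ f`) the GLOBAL character is
the product `χ = ∏_{p ∣ f} (ψ_p ∘ mod p^{v_p(f)})` of level `f`: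

* `prod_changeLevel_apply` — `χ(x) = ∏_p ψ_p(x mod p^{v_p(f)})` on units;
* `isPrimitive_prod_changeLevel` — `χ` is PRIMITIVE when every `ψ_p` is (for each `p` a unit
  `k_p ≡ 1 (mod f/p)` with `χ(k_p) = ψ_p(u_p) ≠ 1` is built by the Chinese remainder theorem, so
  `χ` factors through no `f/p`; `isPrimitive_of_forall_not_factorsThrough_div`);
* `exists_odd_isPrimitive` / `exists_even_isPrimitive` — Aoki's standing facts
  "`PC⁻(f) ≠ ∅` unless `2 ∥ f` or `f ∈ {1, 12}`" and "`PC⁺(f) ≠ ∅` unless `2 ∥ f` or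
  `f ∈ {3, 4}`" ([Aoki1983, §3, p. 28]), from the local existence results of
  `FermatHodgeCharacterExistence` by adjusting the parity at one prime.

## References

* [Aoki1983] N. Aoki, On some arithmetic problems related to the Hodge cycles on the Fermat
  varieties, Math. Ann. 266 (1983) 23–54, §3 (p. 28) (text read).
-/

noncomputable section

open Finset

namespace Literature.AlgebraicGeometry.HodgeTheory

namespace FermatCharacter

/-! ### Evaluation of the global character -/

/-- Evaluation of a finite product of Dirichlet characters at a unit. [folklore] -/
theorem finset_prod_apply_unit {f : ℕ} {ι : Type*} (S : Finset ι) (χ : ι → DirichletCharacter ℂ f)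
    (u : (ZMod f)ˣ) : (∏ i ∈ S, χ i) (u : ZMod f) = ∏ i ∈ S, χ i (u : ZMod f) := by
  classical
  induction S using Finset.induction_on with
  | empty => simp [MulChar.one_apply_coe]
  | insert i S hi ih => rw [Finset.prod_insert hi, Finset.prod_insert hi, MulChar.coeToFun_mul,
      Pi.mul_apply, ih]

/-- **The global character on units**: `(∏_p ψ_p ∘ mod p^{v_p f})(x) = ∏_p ψ_p(x mod p^{v_p f})`.
[folklore] -/
theorem prod_changeLevel_apply {f : ℕ}
    (ψ : (p : ℕ) → DirichletCharacter ℂ (p ^ f.factorization p)) (x : (ZMod f)ˣ) :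
    (∏ p ∈ f.primeFactors, DirichletCharacter.changeLevel (Nat.ordProj_dvd f p) (ψ p)) (x : ZMod f) =
      ∏ p ∈ f.primeFactors, ψ p (ZMod.unitsMap (Nat.ordProj_dvd f p) x : (ZMod (p ^ f.factorization p))ˣ) := by
  rw [finset_prod_apply_unit]
  refine prod_congr rfl fun p _ ↦ ?_
  rw [DirichletCharacter.changeLevel_eq_cast_of_dvd, ZMod.unitsMap_val]

/-! ### Primitivity of the global character -/

/-- A character of level `f` that factors through no `f/p` (`p ∣ f` prime) is primitive.
[folklore] -/
theorem isPrimitive_of_forall_not_factorsThrough_div {f : ℕ} [NeZero f] (χ : DirichletCharacter ℂ f)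
    (h : ∀ p ∈ f.primeFactors, ¬ χ.FactorsThrough (f / p)) : χ.IsPrimitive := by
  rw [DirichletCharacter.isPrimitive_def]
  by_contra hne
  set d := χ.conductor with hd
  have hdc : d ∣ f := χ.conductor_dvd_level
  have hd0 : d ≠ 0 := χ.conductor_ne_zero
  have hcd : 1 < f / d := by
    obtain ⟨k, hk⟩ := hdc
    have hk1 : k ≠ 1 := fun h1 ↦ hne (by rw [hk, h1, mul_one])
    have hk0 : k ≠ 0 := fun h0 ↦ NeZero.ne f (by rw [hk, h0, mul_zero])
    rw [hk, Nat.mul_div_cancel_left k (Nat.pos_of_ne_zero hd0)]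
    omega
  obtain ⟨p, hp, hpcd⟩ := Nat.exists_prime_and_dvd hcd.ne'
  have hdp : d * p ∣ f := Nat.mul_dvd_of_dvd_div hdc hpcd
  have hpf : p ∣ f := dvd_trans (dvd_mul_left p d) hdp
  have hdfp : d ∣ f / p := Nat.dvd_div_of_mul_dvd (by rwa [mul_comm] at hdp)
  have hfpf : f / p ∣ f := Nat.div_dvd_of_dvd hpf
  exact h p (Nat.mem_primeFactors.mpr ⟨hp, hpf, NeZero.ne f⟩)
    (DirichletCharacter.FactorsThrough.mono χ χ.factorsThrough_conductor hdfp hfpf)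

/-- **A unit of `ℤ/f` with prescribed `p`-component and trivial other components** (CRT): for a
unit `u` of `ℤ/p^{v_p f}` there is a unit `K` of `ℤ/f` reducing to `u` mod `p^{v_p f}` and to
`1` mod `f / p^{v_p f}`. [folklore] -/
theorem exists_unit_localised {f : ℕ} [NeZero f] {p : ℕ} (hp : p ∈ f.primeFactors)
    (u : (ZMod (p ^ f.factorization p))ˣ) :
    ∃ K : (ZMod f)ˣ, ZMod.unitsMap (Nat.ordProj_dvd f p) K = u ∧
      ZMod.unitsMap (Nat.ordCompl_dvd f p) K = 1 := by
  have hpp : p.Prime := Nat.prime_of_mem_primeFactors hp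
  have hf0 : f ≠ 0 := NeZero.ne f
  haveI : NeZero (p ^ f.factorization p) := ⟨pow_ne_zero _ hpp.ne_zero⟩
  have hcop : Nat.Coprime (p ^ f.factorization p) (f / p ^ f.factorization p) :=
    (Nat.coprime_ordCompl hpp hf0).pow_left _
  have hqn : p ^ f.factorization p * (f / p ^ f.factorization p) = f :=
    Nat.ordProj_mul_ordCompl_eq_self f p
  obtain ⟨k, hk1, hk2⟩ := Nat.chineseRemainder hcop.symm 1 (u : ZMod (p ^ f.factorization p)).val
  -- `k` is coprime to `f`
  have hkn : Nat.Coprime k (f / p ^ f.factorization p) := by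
    rw [Nat.Coprime, hk1.gcd_eq, Nat.gcd_one_left]
  have hkq : Nat.Coprime k (p ^ f.factorization p) := by
    rw [Nat.Coprime, hk2.gcd_eq]
    exact ZMod.val_coe_unit_coprime u
  have hkf : Nat.Coprime k f := by
    rw [← hqn]
    exact Nat.Coprime.mul_right hkq hkn
  refine ⟨ZMod.unitOfCoprime k hkf, ?_, ?_⟩
  · ext
    rw [ZMod.unitsMap_val, ZMod.coe_unitOfCoprime, ZMod.cast_natCast (Nat.ordProj_dvd f p),
      (ZMod.natCast_eq_natCast_iff _ _ _).mpr hk2, ZMod.natCast_zmod_val]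
  · ext
    rw [ZMod.unitsMap_val, ZMod.coe_unitOfCoprime, ZMod.cast_natCast (Nat.ordCompl_dvd f p),
      Units.val_one, (ZMod.natCast_eq_natCast_iff _ _ _).mpr hk1, Nat.cast_one]

/-- For distinct primes `p, p'` of `f`, `p'^{v_{p'} f}` divides `f / p^{v_p f}`. [folklore] -/
theorem ordProj_dvd_ordCompl_of_ne {f p p' : ℕ} (hp : p.Prime) (hp' : p'.Prime)
    (hne : p' ≠ p) : p' ^ f.factorization p' ∣ f / p ^ f.factorization p := by
  have hcop : Nat.Coprime (p' ^ f.factorization p') (p ^ f.factorization p) :=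
    Nat.Coprime.pow _ _ ((Nat.coprime_primes hp' hp).mpr hne)
  have hmul : p' ^ f.factorization p' * p ^ f.factorization p ∣ f :=
    Nat.Coprime.mul_dvd_of_dvd_of_dvd hcop (Nat.ordProj_dvd f p') (Nat.ordProj_dvd f p)
  exact Nat.dvd_div_of_mul_dvd (by rwa [mul_comm] at hmul)

/-- **The global character is primitive when all local components are.** For each prime
`p ∣ f` pick `u_p ∈ ker((ℤ/p^{v_p f})ˣ → (ℤ/p^{v_p f - 1})ˣ)` with `ψ_p(u_p) ≠ 1` (`ψ_p` is
primitive) and let `K_p` be the unit of `ℤ/f` with components `(u_p, 1)`; then `K_p ≡ 1 (mod f/p)`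
and `χ(K_p) = ψ_p(u_p) ≠ 1`, so `χ` factors through no `f/p`. [folklore] -/
theorem isPrimitive_prod_changeLevel {f : ℕ} [NeZero f]
    (ψ : (p : ℕ) → DirichletCharacter ℂ (p ^ f.factorization p))
    (hψ : ∀ p ∈ f.primeFactors, (ψ p).IsPrimitive) :
    (∏ p ∈ f.primeFactors, DirichletCharacter.changeLevel (Nat.ordProj_dvd f p) (ψ p)).IsPrimitive := by
  classical
  have hf0 : f ≠ 0 := NeZero.ne f
  refine isPrimitive_of_forall_not_factorsThrough_div _ fun p hp hfac ↦ ?_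
  have hpp : p.Prime := Nat.prime_of_mem_primeFactors hp
  have hpf : p ∣ f := Nat.dvd_of_mem_primeFactors hp
  set e := f.factorization p with he
  have he1 : 1 ≤ e := Nat.Prime.factorization_pos_of_dvd hpp hf0 hpf
  haveI : NeZero (p ^ e) := ⟨pow_ne_zero _ hpp.ne_zero⟩
  -- a unit `u` of `ℤ/p^e`, `≡ 1 (mod p^(e-1))`, with `ψ_p(u) ≠ 1`
  have hnf : ¬ (ψ p).FactorsThrough (p ^ (e - 1)) := by
    intro hft
    have h1 := DirichletCharacter.conductor_dvd_of_mem_conductorSet (ψ p)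
      ((DirichletCharacter.mem_conductorSet_iff _).mpr hft)
    rw [(DirichletCharacter.isPrimitive_def _).mp (hψ p hp)] at h1
    have hle := Nat.le_of_dvd (pow_pos hpp.pos _) h1
    rw [← he] at hle
    have hlt : p ^ (e - 1) < p ^ e := Nat.pow_lt_pow_right hpp.one_lt (by omega)
    omega
  obtain ⟨u, hu, hψu⟩ := exists_ker_apply_ne_one (pow_dvd_pow p (Nat.sub_le e 1)) hnf
  obtain ⟨K, hK1, hK2⟩ := exists_unit_localised hp u
  -- `K ≡ 1 (mod f/p)`
  have hfp : f / p ∣ f := Nat.div_dvd_of_dvd hpf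
  have hKer : ZMod.unitsMap hfp K = 1 := by
    ext
    rw [ZMod.unitsMap_val, Units.val_one]
    -- compare in `ℤ/(f/p)` via the natural number `(K : ZMod f).val`
    set k := (K : ZMod f).val with hk
    have hkK : ((k : ℕ) : ZMod f) = K := ZMod.natCast_zmod_val _
    have hcast : ((K : ZMod f).cast : ZMod (f / p)) = ((k : ℕ) : ZMod (f / p)) := by
      rw [← hkK, ZMod.cast_natCast hfp]
    rw [hcast]
    -- `k ≡ 1 (mod p^(e-1))` and `k ≡ 1 (mod f/p^e)`
    have h1 : k ≡ 1 [MOD p ^ (e - 1)] := by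
      have hv := congrArg (fun z : (ZMod (p ^ (e - 1)))ˣ ↦ (z : ZMod (p ^ (e - 1)))) hu
      simp only [ZMod.unitsMap_val, Units.val_one] at hv
      have hv1 := congrArg (fun z : (ZMod (p ^ e))ˣ ↦ (z : ZMod (p ^ e))) hK1
      simp only [ZMod.unitsMap_val] at hv1
      -- `(k : ZMod p^(e-1)) = 1`
      rw [← ZMod.natCast_eq_natCast_iff, Nat.cast_one]
      have : ((k : ℕ) : ZMod (p ^ (e - 1))) =
          (((K : ZMod f).cast : ZMod (p ^ e)).cast : ZMod (p ^ (e - 1))) := by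
        rw [← hkK, ZMod.cast_natCast (Nat.ordProj_dvd f p), ZMod.cast_natCast
          (pow_dvd_pow p (Nat.sub_le e 1))]
      rw [this, hv1, hv]
    have h2 : k ≡ 1 [MOD f / p ^ e] := by
      have hv2 := congrArg (fun z : (ZMod (f / p ^ e))ˣ ↦ (z : ZMod (f / p ^ e))) hK2
      simp only [ZMod.unitsMap_val, Units.val_one] at hv2
      rw [← ZMod.natCast_eq_natCast_iff, Nat.cast_one, ← hv2, ← hkK,
        ZMod.cast_natCast (Nat.ordCompl_dvd f p)]
    have hcop : Nat.Coprime (p ^ (e - 1)) (f / p ^ e) :=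
      ((Nat.coprime_ordCompl hpp hf0).pow_left _)
    have h12 : k ≡ 1 [MOD p ^ (e - 1) * (f / p ^ e)] :=
      (Nat.modEq_and_modEq_iff_modEq_mul hcop).mp ⟨h1, h2⟩
    have hprod : p ^ (e - 1) * (f / p ^ e) = f / p := by
      have hpe : p ^ e = p * p ^ (e - 1) := by
        rw [← pow_succ']; congr 1; omega
      have hfq : f = p ^ e * (f / p ^ e) := (Nat.ordProj_mul_ordCompl_eq_self f p).symm
      symm
      apply Nat.div_eq_of_eq_mul_left hpp.pos
      calc f = p ^ e * (f / p ^ e) := hfq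
        _ = p ^ (e - 1) * (f / p ^ e) * p := by rw [hpe]; ring
    rw [hprod] at h12
    rw [(ZMod.natCast_eq_natCast_iff _ _ _).mpr h12, Nat.cast_one]
  -- so `χ(K) = 1` by the factorisation through `f/p` ...
  have hχK := (DirichletCharacter.factorsThrough_iff_ker_unitsMap hfp).mp hfac
    ((MonoidHom.mem_ker).mpr hKer)
  rw [MonoidHom.mem_ker, Units.ext_iff, MulChar.coe_toUnitHom, Units.val_one,
    prod_changeLevel_apply] at hχK
  -- ... but `χ(K) = ψ_p(u) ≠ 1`
  rw [← Finset.mul_prod_erase _ _ hp, hK1] at hχK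
  have hothers : ∏ p' ∈ f.primeFactors.erase p,
      ψ p' (ZMod.unitsMap (Nat.ordProj_dvd f p') K : (ZMod (p' ^ f.factorization p'))ˣ) = 1 := by
    refine Finset.prod_eq_one fun p' hp' ↦ ?_
    have hp'p : p' ≠ p := Finset.ne_of_mem_erase hp'
    have hp'' : p'.Prime := Nat.prime_of_mem_primeFactors (Finset.mem_of_mem_erase hp')
    have hdvd : p' ^ f.factorization p' ∣ f / p ^ e := ordProj_dvd_ordCompl_of_ne hpp hp'' hp'p
    have : ZMod.unitsMap (Nat.ordProj_dvd f p') K = 1 := by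
      rw [← ZMod.unitsMap_comp hdvd (Nat.ordCompl_dvd f p), MonoidHom.comp_apply, hK2, map_one]
    rw [this, Units.val_one, map_one]
  rw [hothers, mul_one] at hχK
  exact hψu hχK

/-! ### Non-emptiness of `PC⁻(f)` and `PC⁺(f)` ([Aoki1983, §3, p. 28]) -/

/-- Transport of the existence of characters along an equality of levels. [folklore] -/
theorem exists_char_of_level_eq {N f : ℕ} (h : N = f) (P : ∀ M : ℕ, DirichletCharacter ℂ M → Prop)
    (hex : ∃ χ : DirichletCharacter ℂ N, P N χ) : ∃ χ : DirichletCharacter ℂ f, P f χ := by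
  subst h
  exact hex


/-- Local odd primitive characters exist at every prime power `p^e ≠ 2` (`e ≥ 1`). [folklore] -/
theorem exists_odd_isPrimitive_local {p e : ℕ} (hp : p.Prime) (he : 1 ≤ e) (h2 : p ^ e ≠ 2) :
    ∃ χ : DirichletCharacter ℂ (p ^ e), χ.Odd ∧ χ.IsPrimitive := by
  by_cases he1 : e = 1
  · subst he1
    rw [pow_one] at h2 ⊢
    exact exists_odd_isPrimitive_prime hp h2
  · by_cases h4 : p ^ e = 4
    · -- the odd character mod `4` is primitive
      have key : ∃ χ : DirichletCharacter ℂ 4, χ.Odd ∧ χ.IsPrimitive := by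
        obtain ⟨χ, hodd⟩ := exists_odd_char (N := 4) (by norm_num)
        refine ⟨χ, hodd, ?_⟩
        rw [DirichletCharacter.isPrimitive_def]
        have hdvd : χ.conductor ∣ 4 := χ.conductor_dvd_level
        have hc : χ.conductor ∈ Nat.divisors 4 := Nat.mem_divisors.mpr ⟨hdvd, by norm_num⟩
        have hdiv : Nat.divisors 4 = {1, 2, 4} := by decide
        rw [hdiv] at hc
        simp only [Finset.mem_insert, Finset.mem_singleton] at hc
        have hne1 : χ ≠ 1 := by
          intro h1
          rw [h1, DirichletCharacter.Odd,
            show (-1 : ZMod 4) = ((-1 : (ZMod 4)ˣ) : ZMod 4) by simp, MulChar.one_apply_coe] at hodd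
          norm_num at hodd
        rcases hc with h1 | h2 | h4'
        · exact absurd ((DirichletCharacter.eq_one_iff_conductor_eq_one (χ := χ)).mpr h1) hne1
        · -- factoring through `2` forces `χ = 1`
          exfalso
          obtain ⟨_, χ₀, hχ₀⟩ := (DirichletCharacter.mem_conductorSet_iff_conductor_dvd χ
            (show (2 : ℕ) ∣ 4 by norm_num)).mpr (h2 ▸ dvd_refl _)
          have htriv : χ₀ = 1 := by
            apply MulChar.ext
            intro u
            have hu : u = 1 := by revert u; decide
            rw [hu, Units.val_one, map_one, map_one]
          rw [htriv, map_one] at hχ₀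
          exact hne1 hχ₀
        · exact h4'
      exact exists_char_of_level_eq h4.symm (fun M χ ↦ χ.Odd ∧ χ.IsPrimitive) key
    · exact exists_odd_isPrimitive_primePow hp (by omega) h4

/-- Local even primitive characters exist at every prime power `p^e ∉ {2, 3, 4}` (`e ≥ 1`).
[folklore] -/
theorem exists_even_isPrimitive_local {p e : ℕ} (hp : p.Prime) (he : 1 ≤ e) (h2 : p ^ e ≠ 2)
    (h3 : p ^ e ≠ 3) (h4 : p ^ e ≠ 4) :
    ∃ χ : DirichletCharacter ℂ (p ^ e), χ.Even ∧ χ.IsPrimitive := by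
  by_cases he1 : e = 1
  · subst he1
    rw [pow_one] at h2 h3 ⊢
    have h5 : 5 ≤ p := by
      have := hp.two_le
      by_contra hlt
      interval_cases p <;> simp_all (config := {decide := true})
    exact exists_even_isPrimitive_prime hp h5
  · exact exists_even_isPrimitive_primePow hp (by omega) h4

/-- The parity of the global character: `χ(-1) = ∏_p ψ_p(-1)`. [folklore] -/
theorem prod_changeLevel_neg_one {f : ℕ} [NeZero f]
    (ψ : (p : ℕ) → DirichletCharacter ℂ (p ^ f.factorization p)) :
    (∏ p ∈ f.primeFactors, DirichletCharacter.changeLevel (Nat.ordProj_dvd f p) (ψ p)) (-1) =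
      ∏ p ∈ f.primeFactors, ψ p (-1) := by
  rw [show (-1 : ZMod f) = ((-1 : (ZMod f)ˣ) : ZMod f) by simp, prod_changeLevel_apply]
  refine prod_congr rfl fun p _ ↦ ?_
  rw [ZMod.unitsMap_def, Units.coe_map, MonoidHom.coe_coe, Units.val_neg, Units.val_one,
    map_neg (ZMod.castHom (Nat.ordProj_dvd f p) (ZMod (p ^ f.factorization p))), map_one]

/-- **`PC⁻(f) ≠ ∅` and `PC⁺(f) ≠ ∅`** ([Aoki1983, §3, p. 28]: "`PC(m)` is empty if
`ord₂(m) = 1` … `PC⁺(3)`, `PC⁺(4)` and `PC⁻(12)` are also empty"): for `f` odd or divisible by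
`4` there is an odd primitive character mod `f` unless `f ∈ {1, 12}`, and an even primitive
character unless `f ∈ {3, 4}`. Proof by induction on `f`, peeling off the prime power `q` of the
smallest prime and multiplying local characters of suitable parities (`prodChar_isPrimitive`).
[cite: Aoki1983, §3 (p. 28)] -/
theorem exists_isPrimitive_odd_and_even (f : ℕ) (hf0 : f ≠ 0) (hval : Odd f ∨ 4 ∣ f) :
    (f ≠ 1 → f ≠ 12 → ∃ χ : DirichletCharacter ℂ f, χ.Odd ∧ χ.IsPrimitive) ∧
    (f ≠ 3 → f ≠ 4 → ∃ χ : DirichletCharacter ℂ f, χ.Even ∧ χ.IsPrimitive) := by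
  induction f using Nat.strong_induction_on with
  | _ f ih =>
  haveI : NeZero f := ⟨hf0⟩
  by_cases hf1 : f = 1
  · subst hf1
    refine ⟨fun h ↦ absurd rfl h, fun _ _ ↦ ⟨1, ?_, DirichletCharacter.isPrimitive_one_level_one⟩⟩
    rw [DirichletCharacter.Even, MulChar.one_apply (isUnit_of_subsingleton _)]
  -- peel off the prime power of the smallest prime
  set p := f.minFac with hp
  have hpp : p.Prime := Nat.minFac_prime hf1
  have hpf : p ∣ f := Nat.minFac_dvd f
  set e := f.factorization p with he
  have he1 : 1 ≤ e := Nat.Prime.factorization_pos_of_dvd hpp hf0 hpf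
  set q := p ^ e with hq
  set n := f / p ^ e with hn
  haveI : NeZero q := ⟨pow_ne_zero _ hpp.ne_zero⟩
  have hqn : q * n = f := Nat.ordProj_mul_ordCompl_eq_self f p
  have hcop : Nat.Coprime q n := (Nat.coprime_ordCompl hpp hf0).pow_left _
  have hn0 : n ≠ 0 := fun h0 ↦ hf0 (by rw [← hqn, h0, mul_zero])
  haveI : NeZero n := ⟨hn0⟩
  have hq1 : 1 < q := Nat.one_lt_pow (by omega) hpp.one_lt
  have hnlt : n < f := by
    rw [← hqn]
    exact lt_mul_left (Nat.pos_of_ne_zero hn0) hq1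
  -- `n` is odd (the full `2`-part is in `q` when `f` is even)
  have hnodd : Odd n := by
    rcases hval with hodd | h4
    · exact hodd.of_dvd_nat ⟨q, by rw [mul_comm, hqn]⟩
    · have hp2 : p = 2 := by
        have h2f : 2 ∣ f := dvd_trans (by norm_num) h4
        exact le_antisymm (Nat.minFac_le_of_dvd le_rfl h2f) hpp.two_le
      rw [Nat.odd_iff]
      by_contra hne
      have h2n : 2 ∣ n := Nat.dvd_of_mod_eq_zero (by omega)
      have := (Nat.coprime_ordCompl hpp hf0)
      rw [hp2] at this
      exact absurd (Nat.eq_one_of_dvd_coprimes (hp2 ▸ this : Nat.Coprime 2 n) (dvd_refl 2)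
        (by exact h2n)) (by norm_num)
  have hnval : Odd n ∨ 4 ∣ n := Or.inl hnodd
  -- `q ≠ 2`
  have hq2 : q ≠ 2 := by
    intro h2
    have hpe2 : p ^ e = 2 := h2
    have hdvd : p ∣ p ^ e := dvd_pow_self p (by omega)
    rw [hpe2] at hdvd
    have hp2 : p = 2 := (Nat.prime_dvd_prime_iff_eq hpp Nat.prime_two).mp hdvd
    have he' : e = 1 := by
      rw [hp2] at hpe2
      exact Nat.pow_right_injective le_rfl (hpe2.trans (pow_one 2).symm)
    rcases hval with hodd | h4
    · exact hodd.not_two_dvd_nat (hp2 ▸ hpf)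
    · have h22 : 2 ^ 2 ∣ f := by simpa using h4
      have hle := (Nat.Prime.pow_dvd_iff_le_factorization Nat.prime_two hf0).mp h22
      have : f.factorization 2 = e := by rw [he, hp2]
      omega
  -- local characters at `q`
  have hOPq : ∃ χ : DirichletCharacter ℂ q, χ.Odd ∧ χ.IsPrimitive :=
    exists_odd_isPrimitive_local hpp he1 hq2
  have hEPq : q ≠ 3 → q ≠ 4 → ∃ χ : DirichletCharacter ℂ q, χ.Even ∧ χ.IsPrimitive :=
    fun h3 h4 ↦ exists_even_isPrimitive_local hpp he1 hq2 h3 h4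
  -- induction hypothesis at `n`
  have hIH := ih n hnlt hn0 hnval
  have hn12 : n ≠ 12 := fun h ↦ by rw [h] at hnodd; exact absurd hnodd (by decide)
  have hn4 : n ≠ 4 := fun h ↦ by rw [h] at hnodd; exact absurd hnodd (by decide)
  -- the four combination rules, transported to level `f`
  have ruleOE : (∃ χ : DirichletCharacter ℂ q, χ.Odd ∧ χ.IsPrimitive) →
      (∃ χ : DirichletCharacter ℂ n, χ.Even ∧ χ.IsPrimitive) →
      ∃ χ : DirichletCharacter ℂ f, χ.Odd ∧ χ.IsPrimitive := by
    rintro ⟨χ₁, ho, hp1⟩ ⟨χ₂, hev, hp2⟩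
    exact exists_char_of_level_eq hqn (fun M χ ↦ χ.Odd ∧ χ.IsPrimitive)
      ⟨_, prodChar_odd_of_odd_even ho hev, prodChar_isPrimitive hcop hp1 hp2⟩
  have ruleEO : (∃ χ : DirichletCharacter ℂ q, χ.Even ∧ χ.IsPrimitive) →
      (∃ χ : DirichletCharacter ℂ n, χ.Odd ∧ χ.IsPrimitive) →
      ∃ χ : DirichletCharacter ℂ f, χ.Odd ∧ χ.IsPrimitive := by
    rintro ⟨χ₁, hev, hp1⟩ ⟨χ₂, ho, hp2⟩
    exact exists_char_of_level_eq hqn (fun M χ ↦ χ.Odd ∧ χ.IsPrimitive)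
      ⟨_, prodChar_odd_of_even_odd hev ho, prodChar_isPrimitive hcop hp1 hp2⟩
  have ruleOO : (∃ χ : DirichletCharacter ℂ q, χ.Odd ∧ χ.IsPrimitive) →
      (∃ χ : DirichletCharacter ℂ n, χ.Odd ∧ χ.IsPrimitive) →
      ∃ χ : DirichletCharacter ℂ f, χ.Even ∧ χ.IsPrimitive := by
    rintro ⟨χ₁, ho, hp1⟩ ⟨χ₂, ho', hp2⟩
    exact exists_char_of_level_eq hqn (fun M χ ↦ χ.Even ∧ χ.IsPrimitive)
      ⟨_, prodChar_even_of_odd_odd ho ho', prodChar_isPrimitive hcop hp1 hp2⟩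
  have ruleEE : (∃ χ : DirichletCharacter ℂ q, χ.Even ∧ χ.IsPrimitive) →
      (∃ χ : DirichletCharacter ℂ n, χ.Even ∧ χ.IsPrimitive) →
      ∃ χ : DirichletCharacter ℂ f, χ.Even ∧ χ.IsPrimitive := by
    rintro ⟨χ₁, hev, hp1⟩ ⟨χ₂, hev', hp2⟩
    exact exists_char_of_level_eq hqn (fun M χ ↦ χ.Even ∧ χ.IsPrimitive)
      ⟨_, prodChar_even_of_even_even hev hev', prodChar_isPrimitive hcop hp1 hp2⟩
  -- the even primitive character mod `1`
  have hEP1 : n = 1 → ∃ χ : DirichletCharacter ℂ n, χ.Even ∧ χ.IsPrimitive := by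
    intro hn1
    refine exists_char_of_level_eq hn1.symm (fun M χ ↦ χ.Even ∧ χ.IsPrimitive)
      ⟨1, ?_, DirichletCharacter.isPrimitive_one_level_one⟩
    rw [DirichletCharacter.Even, MulChar.one_apply (isUnit_of_subsingleton _)]
  constructor
  · -- odd primitive mod `f`
    intro _ hf12
    by_cases hn1 : n = 1
    · exact ruleOE hOPq (hEP1 hn1)
    by_cases hn3 : n = 3
    · -- `f = 3 q` with `q = 2^e`, `e ≥ 2`; `q ≠ 4` as `f ≠ 12`
      have hOP3 : ∃ χ : DirichletCharacter ℂ n, χ.Odd ∧ χ.IsPrimitive :=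
        exists_char_of_level_eq hn3.symm (fun M χ ↦ χ.Odd ∧ χ.IsPrimitive)
          (exists_odd_isPrimitive_prime Nat.prime_three (by norm_num))
      refine ruleEO (hEPq ?_ ?_) hOP3
      · intro hq3
        have : Nat.Coprime 3 3 := by
          have h := hcop; rw [hq3, hn3] at h; exact h
        norm_num at this
      · intro hq4
        apply hf12
        rw [← hqn, hq4, hn3]
    · exact ruleOE hOPq (hIH.2 hn3 hn4)
  · -- even primitive mod `f`
    intro hf3 hf4
    by_cases hn1 : n = 1
    · refine ruleEE (hEPq ?_ ?_) (hEP1 hn1)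
      · intro hq3; apply hf3; rw [← hqn, hq3, hn1]
      · intro hq4; apply hf4; rw [← hqn, hq4, hn1]
    by_cases hn3 : n = 3
    · have hOP3 : ∃ χ : DirichletCharacter ℂ n, χ.Odd ∧ χ.IsPrimitive :=
        exists_char_of_level_eq hn3.symm (fun M χ ↦ χ.Odd ∧ χ.IsPrimitive)
          (exists_odd_isPrimitive_prime Nat.prime_three (by norm_num))
      exact ruleOO hOPq hOP3
    by_cases hq34 : q = 3 ∨ q = 4
    · exact ruleOO hOPq (hIH.1 hn1 hn12)
    · push Not at hq34
      exact ruleEE (hEPq hq34.1 hq34.2) (hIH.2 hn3 hn4)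

/-- **`PC⁻(f) ≠ ∅`** for `f` odd or divisible by `4`, `f ∉ {1, 12}`. [cite: Aoki1983, §3 (p. 28)] -/
theorem exists_odd_isPrimitive {f : ℕ} [NeZero f] (hval : Odd f ∨ 4 ∣ f) (h1 : f ≠ 1)
    (h12 : f ≠ 12) : ∃ χ : DirichletCharacter ℂ f, χ.Odd ∧ χ.IsPrimitive :=
  (exists_isPrimitive_odd_and_even f (NeZero.ne f) hval).1 h1 h12

/-- **`PC⁺(f) ≠ ∅`** for `f` odd or divisible by `4`, `f ∉ {3, 4}`. [cite: Aoki1983, §3 (p. 28)] -/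
theorem exists_even_isPrimitive {f : ℕ} [NeZero f] (hval : Odd f ∨ 4 ∣ f) (h3 : f ≠ 3)
    (h4 : f ≠ 4) : ∃ χ : DirichletCharacter ℂ f, χ.Even ∧ χ.IsPrimitive :=
  (exists_isPrimitive_odd_and_even f (NeZero.ne f) hval).2 h3 h4

end FermatCharacter

end Literature.AlgebraicGeometry.HodgeTheory
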